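import Summits.ValiantsHypothesis.ValiantsHypothesis.Theorems.BarrierLeverTransversalMinorLayoutsRankEightCells
import Summits.ValiantsHypothesis.ValiantsHypothesis.Theorems.BarrierLeverTransversalMinorLayoutsEightFacesNoDegOne
import Summits.ValiantsHypothesis.ValiantsHypothesis.Theorems.BarrierLeverTransversalMinorLayoutsLockedCertsEight
import Summits.ValiantsHypothesis.ValiantsHypothesis.Theorems.BarrierLeverTransversalMinorLayoutsClawSimplexSeven
import Summits.ValiantsHypothesis.ValiantsHypothesis.Theorems.BarrierLeverTransversalMinorLayoutsRelabelGood

/-!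
# Route BarrierLever — item `TransversalLayoutsRankLeEight` (stmt-ValiantsHypothesis-19933):
# the locked cell with eight faces at height 7 — the 7-claw

Helper file (`--supports stmt-ValiantsHypothesis-19933`; cell valiant-natproofs, rung V4, 𝒟-side of
door (c); seat val-np-p1 gen 8).  Cell `(7, 8)` of the bounded engine: the full side is the
`7`-CLAW (every coordinate of degree one), so the other side has no vertex of degree one and is a
SOLID TRIANGLE, a `4`-PATH or a `3`-STAR (`lowerFamily_eight_no_degree_one`).  The path and the star
are settled by the priority-peeling certificates `claw7_v_path4_h7_derivable`,
`claw7_v_star_h7_derivable` (`…LockedCertsEight`, transported by `good_of_ppDerivable_relabel`), the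
solid triangle by the word certificate `claw7_v_simplex_h7_good` (`…ClawSimplexSeven`, transported
at the level of the conclusion by `tt_layout_relabel` and `Compression.tt_layout_of_perm`).

* `good_claw_h7_r8` — cell `(7, 8)`.

WHAT THIS IS NOT: one cell of a bounded-rank slice of TT; nothing on TT / 19930 in general, on crux
stmt-ValiantsHypothesis-14610, or on `VP` versus `VNP`.
-/

-- layout Summits/ValiantsHypothesis/ValiantsHypothesis forces the duplicated namespace component
set_option linter.dupNamespace false

open Matrix Finset

namespace Summit.ValiantsHypothesis.ValiantsHypothesis.Theorems.BarrierLever.FiniteCheck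

open Summit.ValiantsHypothesis.ValiantsHypothesis.Theorems.BarrierLever.Compression
open Summit.ValiantsHypothesis.ValiantsHypothesis.Theorems.BarrierLever.PriorityPeeling

set_option maxRecDepth 20000 in
/-- **Cell `(7, 8)`.**  A `7`-claw against an eight-face complex without a vertex of degree one is
GOOD. -/
theorem good_claw_h7_r8 (u w : Fin 8 → Finset (Fin 7)) (hu : Function.Injective u)
    (hw : Function.Injective w) (hlu : IsLowerSet (Set.range u)) (hlw : IsLowerSet (Set.range w))
    (hfull : ∀ a : Fin 7, ∃ i, a ∈ u i)
    (hdeg : ∀ c : Fin 7, (Finset.univ.filter fun j => c ∈ w j).card ≠ 1) :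
    ∃ H : Matrix (Fin (7 + 7)) (Fin (7 + 7)) ℂ, (Matrix.of fun i j : Fin 8 => (H.submatrix
      (fun a : Fin 7 => if a ∈ u i then Fin.castAdd 7 a else Fin.natAdd 7 a)
      (fun c : Fin 7 => if c ∈ w j then Fin.natAdd 7 c else Fin.castAdd 7 c)).det).det ≠ 0 := by
  classical
  obtain ⟨hlow, hcard, hdegeq⟩ := image_lowerFamily w hw hlw
  have hdeg' : ∀ c : Fin 7, ((Finset.univ.image w).filter fun y => c ∈ y).card ≠ 1 :=
    fun c => by rw [hdegeq]; exact hdeg c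
  -- rows: the faces of `u` are `∅` and singletons, i.e. faces of the standard claw
  have hrows0 : ∀ i, ∃ i', u i = (![∅, {0}, {1}, {2}, {3}, {4}, {5}, {6}] : Fin 8 → Finset (Fin 7)) i' := by
    intro i
    have hi := face_card_le_one_of_claw u hu hlu hfull rfl i
    rcases Nat.lt_or_ge (u i).card 1 with h0 | h1
    · rw [Finset.card_eq_zero.mp (show (u i).card = 0 by omega)]
      exact ⟨0, rfl⟩
    · obtain ⟨x, hx⟩ := Finset.card_eq_one.mp (le_antisymm hi h1)
      rw [hx]
      exact (by decide : ∀ x : Fin 7, ∃ i' : Fin 8, ({x} : Finset (Fin 7)) =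
        (![∅, {0}, {1}, {2}, {3}, {4}, {5}, {6}] : Fin 8 → Finset (Fin 7)) i') x
  have hrows : ∀ i, ∃ i', (u i).map (Equiv.refl (Fin 7)).toEmbedding =
      (![∅, {0}, {1}, {2}, {3}, {4}, {5}, {6}] : Fin 8 → Finset (Fin 7)) i' := by
    intro i
    rw [Equiv.refl_toEmbedding, Finset.map_refl]
    exact hrows0 i
  rcases lowerFamily_eight_no_degree_one _ hlow hcard hdeg' with
    ⟨a, b, c, hab, hac, hbc, hall⟩ |
    ⟨v₁, v₂, v₃, v₄, h12, h13, h14, h23, h24, h34, -, -, -, -, hall⟩ |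
    ⟨v₀, v₁, v₂, v₃, h01, h02, h03, h12, h13, h23, -, -, -, -, -, hall⟩
  · -- solid triangle: the word certificate, transported at the level of the conclusion
    obtain ⟨π', hπ'⟩ := Equiv.Perm.exists_extending_pair (![a, b, c] : Fin 3 → Fin 7)
      (![0, 1, 2] : Fin 3 → Fin 7) (vec3_injective a b c hab hac hbc) (by decide)
    have hπa : π' a = 0 := hπ' 0
    have hπb : π' b = 1 := hπ' 1
    have hπc : π' c = 2 := hπ' 2
    -- w j = (Δ j').map π'.symm for a face Δ j' of the standard solid triangle
    have hcols : ∀ j, ∃ j', w j =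
        ((![∅, {0}, {1}, {2}, {0, 1}, {0, 2}, {1, 2}, {0, 1, 2}] : Fin 8 → Finset (Fin 7)) j').map
          π'.symm.toEmbedding := by
      intro j
      have hz : (w j).map π'.toEmbedding ∈ (({0, 1, 2} : Finset (Fin 7))).powerset := by
        rw [Finset.mem_powerset]
        have := map_subset_three (w j) a b c π'
          (hall _ (Finset.mem_image.mpr ⟨j, Finset.mem_univ _, rfl⟩))
        rwa [hπa, hπb, hπc] at this
      obtain ⟨j', hj'⟩ := (by decide : ∀ z ∈ (({0, 1, 2} : Finset (Fin 7))).powerset, ∃ j' : Fin 8,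
        z = (![∅, {0}, {1}, {2}, {0, 1}, {0, 2}, {1, 2}, {0, 1, 2}] : Fin 8 → Finset (Fin 7)) j') _ hz
      refine ⟨j', ?_⟩
      rw [← hj', Finset.map_map]
      have : (π'.toEmbedding.trans π'.symm.toEmbedding) = Function.Embedding.refl _ := by
        ext x; simp
      rw [this]
      simp
    -- the certificate, relabeled on the columns by π'⁻¹
    have h0 := tt_layout_relabel 7 8
      (![∅, {0}, {1}, {2}, {3}, {4}, {5}, {6}] : Fin 8 → Finset (Fin 7))
      (![∅, {0}, {1}, {2}, {0, 1}, {0, 2}, {1, 2}, {0, 1, 2}] : Fin 8 → Finset (Fin 7))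
      (Equiv.refl _) π'.symm claw7_v_simplex_h7_good
    simp only [Equiv.refl_toEmbedding, Finset.map_refl] at h0
    -- re-index
    obtain ⟨σ, hσ⟩ := PPSmall.exists_perm_of_forall_exists hrows0 hu
    obtain ⟨τ, hτ⟩ := PPSmall.exists_perm_of_forall_exists hcols hw
    refine tt_layout_of_perm 7 8 u w σ.symm τ.symm ?_
    have e1 : ∀ i, u (σ.symm i) =
        (![∅, {0}, {1}, {2}, {3}, {4}, {5}, {6}] : Fin 8 → Finset (Fin 7)) i := fun i => by
      rw [hσ, Equiv.apply_symm_apply]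
    have e2 : ∀ j, w (τ.symm j) =
        ((![∅, {0}, {1}, {2}, {0, 1}, {0, 2}, {1, 2}, {0, 1, 2}] : Fin 8 → Finset (Fin 7)) j).map
          π'.symm.toEmbedding := fun j => by
      rw [hτ, Equiv.apply_symm_apply]
    simp only [e1, e2]
    exact h0
  · -- four-path
    obtain ⟨π', hπ'⟩ := Equiv.Perm.exists_extending_pair (![v₁, v₂, v₃, v₄] : Fin 4 → Fin 7)
      (![0, 1, 2, 3] : Fin 4 → Fin 7) (vec4_injective v₁ v₂ v₃ v₄ h12 h13 h14 h23 h24 h34) (by decide)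
    have hp1 : π' v₁ = 0 := hπ' 0
    have hp2 : π' v₂ = 1 := hπ' 1
    have hp3 : π' v₃ = 2 := hπ' 2
    have hp4 : π' v₄ = 3 := hπ' 3
    refine good_of_ppDerivable_relabel u w _ _ hu hw (Equiv.refl _) π' hrows ?_
      claw7_v_path4_h7_derivable
    intro j
    rcases hall (w j) (Finset.mem_image.mpr ⟨j, Finset.mem_univ _, rfl⟩) with
      e | e | e | e | e | e | e | e <;> rw [e]
    · exact ⟨0, by simp⟩
    · exact ⟨1, by simp [hp1]⟩
    · exact ⟨2, by simp [hp2]⟩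
    · exact ⟨3, by simp [hp3]⟩
    · exact ⟨4, by simp [hp4]⟩
    · exact ⟨5, by simp [Finset.map_insert, hp1, hp2]⟩
    · exact ⟨6, by simp [Finset.map_insert, hp2, hp3]⟩
    · exact ⟨7, by simp [Finset.map_insert, hp3, hp4]⟩
  · -- three-star
    obtain ⟨π', hπ'⟩ := Equiv.Perm.exists_extending_pair (![v₀, v₁, v₂, v₃] : Fin 4 → Fin 7)
      (![0, 1, 2, 3] : Fin 4 → Fin 7) (vec4_injective v₀ v₁ v₂ v₃ h01 h02 h03 h12 h13 h23) (by decide)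
    have hp0 : π' v₀ = 0 := hπ' 0
    have hp1 : π' v₁ = 1 := hπ' 1
    have hp2 : π' v₂ = 2 := hπ' 2
    have hp3 : π' v₃ = 3 := hπ' 3
    refine good_of_ppDerivable_relabel u w _ _ hu hw (Equiv.refl _) π' hrows ?_
      claw7_v_star_h7_derivable
    intro j
    rcases hall (w j) (Finset.mem_image.mpr ⟨j, Finset.mem_univ _, rfl⟩) with
      e | e | e | e | e | e | e | e <;> rw [e]
    · exact ⟨0, by simp⟩
    · exact ⟨1, by simp [hp0]⟩
    · exact ⟨2, by simp [hp1]⟩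
    · exact ⟨3, by simp [hp2]⟩
    · exact ⟨4, by simp [hp3]⟩
    · exact ⟨5, by simp [Finset.map_insert, hp0, hp1]⟩
    · exact ⟨6, by simp [Finset.map_insert, hp0, hp2]⟩
    · exact ⟨7, by simp [Finset.map_insert, hp0, hp3]⟩

end Summit.ValiantsHypothesis.ValiantsHypothesis.Theorems.BarrierLever.FiniteCheck
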